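import Mathlib.NumberTheory.ArithmeticFunction.Misc
import Mathlib.NumberTheory.SmoothNumbers
import Literature.NumberTheory.Sieve.AsymptoticSieveForPrimesLogSums
import Literature.NumberTheory.Sieve.AsymptoticSieveForPrimesRoughMoebius
import HarnessLib

/-!
# Comparison of two multiplicative functions along the Möbius sum over rough numbers

Topic `Literature/NumberTheory/Sieve` (trunk T-SIEVE); the combinatorial core of the proof of
Friedlander–Iwaniec's Möbius–density cancellation (2.4) (`Literature.NumberTheory.Sieve.fi_moebius_density_cancellation`,
FI pp. 1048–1049). Everything in this file is PROVED (no named facts, no definitions).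

Write `RS(X, L)` for the squarefree `n ∈ [1, X]` all of whose prime factors are `≥ L`
(the support of `μ(n)[(n, P(z)) = 1]`, `L = ⌈z⌉`).

* `sum_roughSquarefree_eq` — **Buchstab decomposition by the least prime factor**:
  `∑_{n ∈ RS(X,L)} Φ(n) = Φ(1) + ∑_{L ≤ p ≤ X} ∑_{n' ∈ RS(X/p, p+1)} Φ(p n')` (bijection
  `n ↦ (P⁻(n), n/P⁻(n))`);
* `sum_primes_mul_sum_rough_eq` — **the swap**: for a fixed cofactor `n'` the admissible primes
  form the interval `[L, min(X/n', P⁻(n') - 1)]`;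
* `abs_sum_moebius_mul_sub_le` — **the comparison lemma**: if `a, b` are multiplicative,
  nonnegative at primes, and `|∑_{u ≤ p ≤ v} (a(p) - b(p))| ≤ h` for all `u ≥ L₀`, then
  `|∑_{n ∈ RS(W,L)} μ(n)(a(n) - b(n))| ≤ h (∑_{n ≤ W sqfree} a(n)) (∑_{n ∈ RS(W,L)} b(n))`
  for `L ≥ L₀`. This is a product-form variant of FI's inequality
  "`|F(w, z) - G_ν(w, z)| ≤ h(z) ∑∑_{mn ≤ w} f(m) g(n)`, which can be seen from the identity
  `f(p₁…p_r) - g(p₁…p_r) = ∑_j f(p₁…p_{j-1})(f(p_j) - g(p_j)) g(p_{j+1}…p_r)`" (p. 1049), proved here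
  by induction on `W` through the Buchstab decomposition (each induction step peels off the least
  prime, which is the telescoping identity read from the left);
* `sum_coprime_moebius_mul_eq_sum_roughSquarefree` — `∑_{n ≤ M, (n, P) = 1} μ(n)θ(n)` is a sum over
  `RS(M, N)` (`P = ∏_{q<N} q`);
* `sum_Icc_mul_apply`, `sum_eq_sum_smooth_mul_sum_coprime` — summing a Dirichlet convolution, and
  the smooth–rough factorisation `∑_{d ≤ Y} a(d) = ∑_{m ≤ Y smooth} a(m) ∑_{n ≤ Y/m, (n,P)=1} a(n)`
  of a multiplicative `a` (the splitting of `G_ν(y)` on FI p. 1048).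

## References

* J. Friedlander, H. Iwaniec, *Asymptotic sieve for primes*, Ann. of Math. 148 (1998),
  1041–1065, §2, pp. 1048–1049. [FriedlanderIwaniecASP1998]

## Mathlib / tree

Mathlib: `Nat.minFac` API, `Finset.sum_nbij'`, `Finset.sum_sigma`, `Nat.smoothNumbers`,
`ArithmeticFunction.IsMultiplicative.eq_iff_eq_on_prime_powers`, `IsMultiplicative.prod_primeFactors`.
`ArithmeticFunction.sum_Ioc_mul_eq_sum_sum` (behind `sum_Icc_mul_apply`).
Tree: `Literature.NumberTheory.Sieve.filter_dvd_Icc_eq_image` (`AsymptoticSieveForPrimesLogSums`),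
`Literature.NumberTheory.Sieve.MoebiusRough.prime_dvd_prod_primesBelow_iff` (`AsymptoticSieveForPrimesRoughMoebius`).
Deliberate local copies (to avoid importing `SieveFrameworkFundamentalLemma`, a different import
tree): `not_dvd_of_primeFactors_gt`, `minFac_prime_mul` restate `Literature.not_dvd_of_lt_primeFactors`,
`Literature.minFac_mul_eq` of `SieveFrameworkFundamentalLemma.lean` up to `mul_comm`; the private
`nonneg_of_squarefree` restates `ArithmeticFunction.IsMultiplicative.nonneg_of_squarefree` of
`AsymptoticSieveForPrimesTyz.lean` (downstream). No Buchstab-type identity for general weights existed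
in Mathlib or the tree (`lean search 'minFac.*sum|Buchstab'`: the tree's `RosserSieveSums` /
`IwaniecAlmostPrimes` Buchstab lemmas are specific to sifting functions).
-/

noncomputable section

open Finset
open scoped ArithmeticFunction.Moebius ArithmeticFunction.zeta

namespace Literature.NumberTheory.Sieve

namespace FIComparison

/-! ### Rough squarefree numbers and the Buchstab decomposition by the least prime factor -/

/-- Membership in the set of squarefree `n ∈ [1, X]` all of whose prime factors are `≥ L`.
[folklore] -/
theorem mem_roughSquarefree {X L n : ℕ} :
    n ∈ (Icc 1 X).filter (fun n => Squarefree n ∧ ∀ q ∈ n.primeFactors, L ≤ q) ↔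
      (1 ≤ n ∧ n ≤ X) ∧ Squarefree n ∧ ∀ q ∈ n.primeFactors, L ≤ q := by
  simp only [Finset.mem_filter, Finset.mem_Icc]

/-- For a prime `p` and `n` with all prime factors `> p`: `p ∤ n`. [folklore] -/
theorem not_dvd_of_primeFactors_gt {p n : ℕ} (hp : p.Prime) (hn : n ≠ 0)
    (h : ∀ q ∈ n.primeFactors, p + 1 ≤ q) : ¬p ∣ n := fun hd => by
  have := h p (Nat.mem_primeFactors.mpr ⟨hp, hd, hn⟩)
  omega

/-- The least prime factor of `p · n` is `p` when all prime factors of `n` exceed `p`.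
[folklore] -/
theorem minFac_prime_mul {p n : ℕ} (hp : p.Prime) (hn : n ≠ 0)
    (h : ∀ q ∈ n.primeFactors, p + 1 ≤ q) : (p * n).minFac = p := by
  refine le_antisymm (Nat.minFac_le_of_dvd hp.two_le (dvd_mul_right p n)) ?_
  have key := (Nat.le_minFac (m := p) (n := p * n)).mpr fun q hq hqd => by
    rcases (Nat.Prime.dvd_mul hq).mp hqd with h1 | h2
    · exact ((Nat.prime_dvd_prime_iff_eq hq hp).mp h1).ge
    · have := h q (Nat.mem_primeFactors.mpr ⟨hq, h2, hn⟩)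
      omega
  rcases key with h1 | h2
  · exfalso
    have : 2 ≤ p * n := le_trans hp.two_le (Nat.le_mul_of_pos_right p (Nat.pos_of_ne_zero hn))
    omega
  · exact h2

/-- **Buchstab decomposition by the least prime factor**: for any `Φ`,
`∑_{n ≤ X sqfree, p | n ⇒ p ≥ L} Φ(n) = Φ(1)[X ≥ 1] + ∑_{L ≤ p ≤ X prime} ∑_{n' ≤ X/p sqfree, q | n' ⇒ q > p} Φ(p n')`
(group `n > 1` according to `p = ` its least prime factor, `n = p n'`). [folklore] -/
theorem sum_roughSquarefree_eq (Φ : ℕ → ℝ) (X L : ℕ) :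
    ∑ n ∈ (Icc 1 X).filter (fun n => Squarefree n ∧ ∀ q ∈ n.primeFactors, L ≤ q), Φ n =
      (if 1 ≤ X then Φ 1 else 0) +
        ∑ p ∈ (Icc L X).filter Nat.Prime,
          ∑ n ∈ (Icc 1 (X / p)).filter (fun n => Squarefree n ∧ ∀ q ∈ n.primeFactors, p + 1 ≤ q),
            Φ (p * n) := by
  classical
  set S := (Icc 1 X).filter (fun n => Squarefree n ∧ ∀ q ∈ n.primeFactors, L ≤ q) with hS
  -- Step 1: split off `n = 1`
  have hsplit : ∑ n ∈ S, Φ n = (if 1 ≤ X then Φ 1 else 0) + ∑ n ∈ S.erase 1, Φ n := by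
    by_cases hX : 1 ≤ X
    · have h1 : (1 : ℕ) ∈ S := by
        rw [hS, mem_roughSquarefree]
        exact ⟨⟨le_rfl, hX⟩, squarefree_one, by simp⟩
      rw [if_pos hX, ← Finset.add_sum_erase S Φ h1]
    · have h1 : (1 : ℕ) ∉ S := by
        rw [hS, mem_roughSquarefree]; omega
      rw [if_neg hX, zero_add, Finset.erase_eq_of_notMem h1]
  rw [hsplit]
  congr 1
  -- Step 2: the bijection `n ↦ (minFac n, n / minFac n)`
  rw [← Finset.sum_sigma ((Icc L X).filter Nat.Prime)
    (fun p => (Icc 1 (X / p)).filter (fun n => Squarefree n ∧ ∀ q ∈ n.primeFactors, p + 1 ≤ q))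
    (fun x => Φ (x.1 * x.2))]
  refine Finset.sum_nbij' (fun n => ⟨n.minFac, n / n.minFac⟩) (fun x => x.1 * x.2) ?_ ?_ ?_ ?_ ?_
  · -- maps into the sigma set
    intro n hn
    obtain ⟨hn1, hnS⟩ := Finset.mem_erase.mp hn
    obtain ⟨⟨hn1', hnX⟩, hsq, hL⟩ := mem_roughSquarefree.mp hnS
    have hn0 : n ≠ 0 := by omega
    have hp : n.minFac.Prime := Nat.minFac_prime hn1
    have hpd : n.minFac ∣ n := Nat.minFac_dvd n
    have hpn : n.minFac ≤ n := Nat.minFac_le (by omega)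
    refine Finset.mem_sigma.mpr ⟨?_, ?_⟩ <;> dsimp only
    · refine Finset.mem_filter.mpr ⟨Finset.mem_Icc.mpr ⟨?_, hpn.trans hnX⟩, hp⟩
      exact hL _ (Nat.mem_primeFactors.mpr ⟨hp, hpd, hn0⟩)
    · refine mem_roughSquarefree.mpr ⟨⟨?_, Nat.div_le_div_right hnX⟩, ?_, ?_⟩
      · exact Nat.div_pos hpn hp.pos
      · exact hsq.squarefree_of_dvd (Nat.div_dvd_of_dvd hpd)
      · intro q hq
        obtain ⟨hqp, hqd, -⟩ := Nat.mem_primeFactors.mp hq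
        have hqn : q ∣ n := hqd.trans (Nat.div_dvd_of_dvd hpd)
        have hle : n.minFac ≤ q := Nat.minFac_le_of_dvd hqp.two_le hqn
        have hne : q ≠ n.minFac := by
          intro hqe
          rw [hqe, Nat.dvd_div_iff_mul_dvd hpd] at hqd
          have := hsq n.minFac hqd
          exact hp.ne_one (Nat.isUnit_iff.mp this)
        omega
  · -- maps back
    rintro ⟨p, n⟩ hx
    simp only [Finset.mem_sigma] at hx
    obtain ⟨hp, hn⟩ := hx
    dsimp only
    obtain ⟨hpI, hpp⟩ := Finset.mem_filter.mp hp
    obtain ⟨hpL, hpX⟩ := Finset.mem_Icc.mp hpI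
    obtain ⟨⟨hn1, hnX⟩, hsq, hgt⟩ := mem_roughSquarefree.mp hn
    have hn0 : n ≠ 0 := by omega
    have hnd : ¬p ∣ n := not_dvd_of_primeFactors_gt hpp hn0 hgt
    refine Finset.mem_erase.mpr ⟨?_, mem_roughSquarefree.mpr ⟨⟨?_, ?_⟩, ?_, ?_⟩⟩
    · intro h1
      have := Nat.eq_one_of_mul_eq_one_right h1
      exact hpp.ne_one this
    · exact le_trans hpp.one_lt.le (Nat.le_mul_of_pos_right p (by omega))
    · exact (Nat.mul_le_mul_left p hnX).trans (Nat.mul_div_le X p)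
    · rw [Nat.squarefree_mul_iff]
      exact ⟨(Nat.Prime.coprime_iff_not_dvd hpp).mpr hnd, hpp.squarefree, hsq⟩
    · intro q hq
      rw [Nat.primeFactors_mul hpp.ne_zero hn0, Finset.mem_union, hpp.primeFactors,
        Finset.mem_singleton] at hq
      rcases hq with rfl | hq
      · exact hpL
      · exact hpL.trans ((Nat.le_succ p).trans (hgt q hq))
  · -- left inverse
    intro n hn
    simp only
    exact Nat.mul_div_cancel' (Nat.minFac_dvd n)
  · -- right inverse
    rintro ⟨p, n⟩ hx
    simp only [Finset.mem_sigma] at hx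
    obtain ⟨hp, hn⟩ := hx
    obtain ⟨-, hpp⟩ := Finset.mem_filter.mp hp
    obtain ⟨⟨hn1, -⟩, -, hgt⟩ := mem_roughSquarefree.mp hn
    have hn0 : n ≠ 0 := by omega
    have hmin : (p * n).minFac = p := minFac_prime_mul hpp hn0 hgt
    simp only
    rw [hmin, Nat.mul_div_cancel_left n hpp.pos]
  · -- values agree
    intro n hn
    simp only
    rw [Nat.mul_div_cancel' (Nat.minFac_dvd n)]

/-! ### Swapping the prime and the cofactor -/

/-- **The swap**: for any `Ψ, θ`,
`∑_{L ≤ p ≤ W prime} Ψ(p) ∑_{n ≤ W/p sqfree, q | n ⇒ q > p} θ(n)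
  = ∑_{n ≤ W sqfree, q | n ⇒ q ≥ L} θ(n) ∑_{L ≤ p ≤ V(n) prime} Ψ(p)`,
`V(n) = min(W/n, P⁻(n) - 1)` (`V(1) = W`): for fixed `n` the admissible primes form an
interval. [folklore] -/
theorem sum_primes_mul_sum_rough_eq (Ψ θ : ℕ → ℝ) (W L : ℕ) :
    ∑ p ∈ (Icc L W).filter Nat.Prime, Ψ p *
        ∑ n ∈ (Icc 1 (W / p)).filter (fun n => Squarefree n ∧ ∀ q ∈ n.primeFactors, p + 1 ≤ q),
          θ n =
      ∑ n ∈ (Icc 1 W).filter (fun n => Squarefree n ∧ ∀ q ∈ n.primeFactors, L ≤ q),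
        θ n * ∑ p ∈ (Icc L (if n = 1 then W else min (W / n) (n.minFac - 1))).filter Nat.Prime,
          Ψ p := by
  classical
  -- the joint condition
  set cond : ℕ → ℕ → Prop := fun p n => n ≤ W / p ∧ Squarefree n ∧ ∀ q ∈ n.primeFactors, p + 1 ≤ q
    with hcond
  -- Step 1: inner sets as filters of `Icc 1 W`
  have hinner : ∀ p ∈ (Icc L W).filter Nat.Prime,
      (Icc 1 (W / p)).filter (fun n => Squarefree n ∧ ∀ q ∈ n.primeFactors, p + 1 ≤ q) =
        (Icc 1 W).filter (fun n => cond p n) := by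
    intro p _
    ext n
    simp only [Finset.mem_filter, Finset.mem_Icc, hcond]
    constructor
    · rintro ⟨⟨h1, h2⟩, h3, h4⟩
      exact ⟨⟨h1, h2.trans (Nat.div_le_self W p)⟩, h2, h3, h4⟩
    · rintro ⟨⟨h1, -⟩, h2, h3, h4⟩
      exact ⟨⟨h1, h2⟩, h3, h4⟩
  have hL : ∑ p ∈ (Icc L W).filter Nat.Prime, Ψ p *
      ∑ n ∈ (Icc 1 (W / p)).filter (fun n => Squarefree n ∧ ∀ q ∈ n.primeFactors, p + 1 ≤ q), θ n =
      ∑ p ∈ (Icc L W).filter Nat.Prime, ∑ n ∈ Icc 1 W, if cond p n then Ψ p * θ n else 0 := by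
    refine Finset.sum_congr rfl fun p hp => ?_
    rw [hinner p hp, Finset.mul_sum, Finset.sum_filter]
  rw [hL, Finset.sum_comm, Finset.sum_filter]
  refine Finset.sum_congr rfl fun n hn => ?_
  obtain ⟨hn1, hnW⟩ := Finset.mem_Icc.mp hn
  have hn0 : n ≠ 0 := by omega
  by_cases hR : Squarefree n ∧ ∀ q ∈ n.primeFactors, L ≤ q
  · rw [if_pos hR, Finset.mul_sum, Finset.sum_filter, Finset.sum_filter]
    -- compare the two indicator sums over `p`
    set V : ℕ := if n = 1 then W else min (W / n) (n.minFac - 1) with hV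
    have hVW : V ≤ W := by
      rw [hV]; split_ifs
      · exact le_rfl
      · exact (min_le_left _ _).trans (Nat.div_le_self W n)
    -- characterisation of `cond p n` for primes `p ≥ 1`
    have hchar : ∀ p : ℕ, p.Prime → (cond p n ↔ p ≤ V) := by
      intro p hp
      simp only [hcond]
      have h1 : n ≤ W / p ↔ p ≤ W / n := by
        rw [Nat.le_div_iff_mul_le hp.pos, Nat.le_div_iff_mul_le (by omega), mul_comm]
      constructor
      · rintro ⟨hle, -, hq⟩
        rw [hV]
        split_ifs with h1'
        · exact (h1.mp hle).trans (Nat.div_le_self W n)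
        · refine le_min (h1.mp hle) ?_
          have hmf : n.minFac ∈ n.primeFactors :=
            Nat.mem_primeFactors.mpr ⟨Nat.minFac_prime h1', Nat.minFac_dvd n, hn0⟩
          have := hq _ hmf
          omega
      · intro hpV
        rw [hV] at hpV
        split_ifs at hpV with h1'
        · subst h1'
          refine ⟨by rw [Nat.le_div_iff_mul_le hp.pos, one_mul]; exact hpV, squarefree_one, by simp⟩
        · refine ⟨h1.mpr (hpV.trans (min_le_left _ _)), hR.1, fun q hq => ?_⟩
          have hq' := Nat.minFac_le_of_dvd (Nat.prime_of_mem_primeFactors hq).two_le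
            (Nat.dvd_of_mem_primeFactors hq)
          have := hpV.trans (min_le_right _ _)
          have h2 := (Nat.minFac_prime h1').two_le
          omega
    -- rewrite the right-hand sum over `Icc L W` with the indicator of `p ≤ V`
    have hset : (Icc L W).filter (fun p => p ≤ V) = Icc L V := by
      ext p
      simp only [Finset.mem_filter, Finset.mem_Icc]
      omega
    rw [← hset, Finset.sum_filter]
    refine Finset.sum_congr rfl fun p _ => ?_
    by_cases hpp : p.Prime
    · by_cases hc : cond p n
      · rw [if_pos hpp, if_pos hc, if_pos ((hchar p hpp).mp hc), if_pos hpp, mul_comm]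
      · rw [if_pos hpp, if_neg hc, if_neg (fun h => hc ((hchar p hpp).mpr h))]
    · rw [if_neg hpp]
      split_ifs <;> rfl
  · rw [if_neg hR]
    refine Finset.sum_eq_zero fun p hp => ?_
    rw [if_neg]
    rintro ⟨-, hsq, hq⟩
    obtain ⟨hpI, -⟩ := Finset.mem_filter.mp hp
    exact hR ⟨hsq, fun q hq' => ((Finset.mem_Icc.mp hpI).1.trans (Nat.le_succ p)).trans (hq q hq')⟩

/-! ### The comparison lemma -/

/-- A multiplicative function with nonnegative values at the primes is nonnegative on squarefree
numbers. (Private: this duplicates `ArithmeticFunction.IsMultiplicative.nonneg_of_squarefree` of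
`AsymptoticSieveForPrimesTyz.lean`, which lies downstream of the present file; pending
consolidation into a shared upstream file.) [folklore] -/
private theorem nonneg_of_squarefree {a : ArithmeticFunction ℝ} (ha : a.IsMultiplicative)
    (ha0 : ∀ p : ℕ, p.Prime → 0 ≤ a p) {n : ℕ} (hn : Squarefree n) : 0 ≤ a n := by
  rw [← ha.prod_primeFactors hn]
  exact Finset.prod_nonneg fun p hp => ha0 p (Nat.prime_of_mem_primeFactors hp)

/-- `μ(p n') a(p n') = -a(p) μ(n') a(n')` when all prime factors of `n'` exceed the prime `p`.
[folklore] -/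
theorem moebius_mul_apply_prime_mul {a : ArithmeticFunction ℝ} (ha : a.IsMultiplicative)
    {p n : ℕ} (hp : p.Prime) (hn : n ≠ 0) (h : ∀ q ∈ n.primeFactors, p + 1 ≤ q) :
    (μ (p * n) : ℝ) * a (p * n) = -(a p * ((μ n : ℝ) * a n)) := by
  have hcop : Nat.Coprime p n :=
    (Nat.Prime.coprime_iff_not_dvd hp).mpr (not_dvd_of_primeFactors_gt hp hn h)
  rw [ArithmeticFunction.isMultiplicative_moebius.map_mul_of_coprime hcop,
    ha.map_mul_of_coprime hcop, ArithmeticFunction.moebius_apply_prime hp]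
  push_cast
  ring

/-- **Comparison lemma** (the mechanism of Friedlander–Iwaniec's estimate of
`|F(w, z) - G_ν(w, z)|`, p. 1049: "which can be seen from the identity
`f(p₁…p_r) - g(p₁…p_r) = ∑_j f(p₁…p_{j-1})(f(p_j) - g(p_j)) g(p_{j+1}…p_r)`").
Let `a, b` be real multiplicative functions, nonnegative at the primes, and suppose that
`|∑_{u ≤ p ≤ v prime} (a(p) - b(p))| ≤ h` for all `u ≥ L₀` and all `v` (so `h ≥ 0`, taking `v < u`).
Then for all `W` and `L ≥ L₀`,
`|∑_{n ≤ W sqfree, p|n ⇒ p ≥ L} μ(n)(a(n) - b(n))| ≤ h (∑_{n ≤ W sqfree} a(n)) (∑_{n ≤ W sqfree, p|n ⇒ p ≥ L} b(n))`.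
We argue by induction on `W` through the Buchstab decomposition (equivalent to the displayed
identity): `A - B = -∑_p (a(p) - b(p)) A_p - ∑_p b(p)(A_p - B_p)` with `A_p, B_p` the sums at
`(W/p, p+1)`; in the first sum the primes attached to a fixed cofactor form an interval
(`sum_primes_mul_sum_rough_eq`), the second is handled by the induction hypothesis and
`∑_p b(p) S_b(W/p, p+1) = S_b(W, L) - 1`. [cite: FriedlanderIwaniecASP1998, §2 p. 1049] -/
theorem abs_sum_moebius_mul_sub_le {a b : ArithmeticFunction ℝ} (ha : a.IsMultiplicative)
    (hb : b.IsMultiplicative) (ha0 : ∀ p : ℕ, p.Prime → 0 ≤ a p) (hb0 : ∀ p : ℕ, p.Prime → 0 ≤ b p)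
    {L₀ : ℕ} {h : ℝ}
    (hyp : ∀ u v : ℕ, L₀ ≤ u → |∑ p ∈ (Icc u v).filter Nat.Prime, (a p - b p)| ≤ h)
    (W L : ℕ) (hL : L₀ ≤ L) :
    |∑ n ∈ (Icc 1 W).filter (fun n => Squarefree n ∧ ∀ q ∈ n.primeFactors, L ≤ q),
        ((μ n : ℝ) * a n - (μ n : ℝ) * b n)| ≤
      h * (∑ n ∈ (Icc 1 W).filter Squarefree, a n) *
        ∑ n ∈ (Icc 1 W).filter (fun n => Squarefree n ∧ ∀ q ∈ n.primeFactors, L ≤ q), b n := by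
  have hh : 0 ≤ h := (abs_nonneg _).trans (hyp L₀ 0 le_rfl)
  induction W using Nat.strong_induction_on generalizing L with
  | _ W ih =>
  rcases Nat.eq_zero_or_pos W with hW0 | hWpos
  · subst hW0
    simp
  have hW1 : 1 ≤ W := hWpos
  classical
  set Sa : ℕ → ℝ := fun X => ∑ n ∈ (Icc 1 X).filter Squarefree, a n with hSa
  -- basic facts
  have hsqf_of_mem : ∀ {X L' n : ℕ}, n ∈ ((Icc 1 X).filter (fun n => Squarefree n ∧ ∀ q ∈ n.primeFactors, L' ≤ q)) → Squarefree n := fun hn =>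
    (mem_roughSquarefree.mp hn).2.1
  have hSa_mono : ∀ {X X' : ℕ}, X ≤ X' → Sa X ≤ Sa X' := by
    intro X X' hXX'
    refine Finset.sum_le_sum_of_subset_of_nonneg ?_ fun n hn _ =>
      nonneg_of_squarefree ha ha0 (Finset.mem_filter.mp hn).2
    exact Finset.filter_subset_filter _ (Finset.Icc_subset_Icc_right hXX')
  have hSb_nonneg : ∀ X L' : ℕ, 0 ≤ ∑ n ∈ ((Icc 1 X).filter (fun n => Squarefree n ∧ ∀ q ∈ n.primeFactors, L' ≤ q)), b n := fun X L' =>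
    Finset.sum_nonneg fun n hn => nonneg_of_squarefree hb hb0 (hsqf_of_mem hn)
  have hRS_sub : ∀ X L' : ℕ, ((Icc 1 X).filter (fun n => Squarefree n ∧ ∀ q ∈ n.primeFactors, L' ≤ q)) ⊆ (Icc 1 X).filter Squarefree := fun X L' n hn =>
    Finset.mem_filter.mpr ⟨(Finset.mem_filter.mp hn).1, hsqf_of_mem hn⟩
  -- Buchstab decompositions of `A`, `B`, `S_b`
  have hA : ∑ n ∈ ((Icc 1 W).filter (fun n => Squarefree n ∧ ∀ q ∈ n.primeFactors, L ≤ q)), (μ n : ℝ) * a n =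
      1 - ∑ p ∈ ((Icc L W).filter Nat.Prime), a p * ∑ n ∈ ((Icc 1 (W / p)).filter (fun n => Squarefree n ∧ ∀ q ∈ n.primeFactors, (p + 1) ≤ q)), (μ n : ℝ) * a n := by
    rw [sum_roughSquarefree_eq (fun n => (μ n : ℝ) * a n) W L, if_pos hW1,
      ArithmeticFunction.moebius_apply_one, ha.map_one, sub_eq_add_neg, ← Finset.sum_neg_distrib]
    push_cast
    rw [one_mul]
    congr 1
    refine Finset.sum_congr rfl fun p hp => ?_
    rw [Finset.mul_sum, ← Finset.sum_neg_distrib]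
    refine Finset.sum_congr rfl fun n hn => ?_
    obtain ⟨⟨hn1, -⟩, -, hgt⟩ := mem_roughSquarefree.mp hn
    exact moebius_mul_apply_prime_mul ha (Finset.mem_filter.mp hp).2 (by omega) hgt
  have hB : ∑ n ∈ ((Icc 1 W).filter (fun n => Squarefree n ∧ ∀ q ∈ n.primeFactors, L ≤ q)), (μ n : ℝ) * b n =
      1 - ∑ p ∈ ((Icc L W).filter Nat.Prime), b p * ∑ n ∈ ((Icc 1 (W / p)).filter (fun n => Squarefree n ∧ ∀ q ∈ n.primeFactors, (p + 1) ≤ q)), (μ n : ℝ) * b n := by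
    rw [sum_roughSquarefree_eq (fun n => (μ n : ℝ) * b n) W L, if_pos hW1,
      ArithmeticFunction.moebius_apply_one, hb.map_one, sub_eq_add_neg, ← Finset.sum_neg_distrib]
    push_cast
    rw [one_mul]
    congr 1
    refine Finset.sum_congr rfl fun p hp => ?_
    rw [Finset.mul_sum, ← Finset.sum_neg_distrib]
    refine Finset.sum_congr rfl fun n hn => ?_
    obtain ⟨⟨hn1, -⟩, -, hgt⟩ := mem_roughSquarefree.mp hn
    exact moebius_mul_apply_prime_mul hb (Finset.mem_filter.mp hp).2 (by omega) hgt
  have hS : ∑ n ∈ ((Icc 1 W).filter (fun n => Squarefree n ∧ ∀ q ∈ n.primeFactors, L ≤ q)), b n =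
      1 + ∑ p ∈ ((Icc L W).filter Nat.Prime), b p * ∑ n ∈ ((Icc 1 (W / p)).filter (fun n => Squarefree n ∧ ∀ q ∈ n.primeFactors, (p + 1) ≤ q)), b n := by
    rw [sum_roughSquarefree_eq (fun n => b n) W L, if_pos hW1, hb.map_one]
    congr 1
    refine Finset.sum_congr rfl fun p hp => ?_
    rw [Finset.mul_sum]
    refine Finset.sum_congr rfl fun n hn => ?_
    obtain ⟨⟨hn1, -⟩, -, hgt⟩ := mem_roughSquarefree.mp hn
    have hp := (Finset.mem_filter.mp hp).2
    have hcop : Nat.Coprime p n :=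
      (Nat.Prime.coprime_iff_not_dvd hp).mpr (not_dvd_of_primeFactors_gt hp (by omega) hgt)
    exact hb.map_mul_of_coprime hcop
  -- the first term: swap and use the hypothesis on prime intervals
  have hT1 : |∑ p ∈ ((Icc L W).filter Nat.Prime), (a p - b p) * ∑ n ∈ ((Icc 1 (W / p)).filter (fun n => Squarefree n ∧ ∀ q ∈ n.primeFactors, (p + 1) ≤ q)), (μ n : ℝ) * a n| ≤
      h * Sa W := by
    rw [sum_primes_mul_sum_rough_eq (fun p => a p - b p) (fun n => (μ n : ℝ) * a n) W L]
    refine (Finset.abs_sum_le_sum_abs _ _).trans ?_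
    calc ∑ n ∈ ((Icc 1 W).filter (fun n => Squarefree n ∧ ∀ q ∈ n.primeFactors, L ≤ q)), |(μ n : ℝ) * a n *
          ∑ p ∈ ((Icc L (if n = 1 then W else min (W / n) (n.minFac - 1))).filter Nat.Prime), (a p - b p)|
        ≤ ∑ n ∈ ((Icc 1 W).filter (fun n => Squarefree n ∧ ∀ q ∈ n.primeFactors, L ≤ q)), a n * h := by
          refine Finset.sum_le_sum fun n hn => ?_
          have hsq := hsqf_of_mem hn
          have han : 0 ≤ a n := nonneg_of_squarefree ha ha0 hsq
          rw [abs_mul]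
          refine mul_le_mul ?_ (hyp L _ hL) (abs_nonneg _) han
          rw [abs_mul, ArithmeticFunction.moebius_apply_of_squarefree hsq]
          push_cast
          rw [abs_pow, abs_neg, abs_one, one_pow, one_mul, abs_of_nonneg han]
      _ = h * ∑ n ∈ ((Icc 1 W).filter (fun n => Squarefree n ∧ ∀ q ∈ n.primeFactors, L ≤ q)), a n := by rw [← Finset.sum_mul, mul_comm]
      _ ≤ h * Sa W := by
          refine mul_le_mul_of_nonneg_left ?_ hh
          exact Finset.sum_le_sum_of_subset_of_nonneg (hRS_sub W L) fun n hn _ =>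
            nonneg_of_squarefree ha ha0 (Finset.mem_filter.mp hn).2
  -- the second term: induction hypothesis
  have hT2 : |∑ p ∈ ((Icc L W).filter Nat.Prime), b p * (∑ n ∈ ((Icc 1 (W / p)).filter (fun n => Squarefree n ∧ ∀ q ∈ n.primeFactors, (p + 1) ≤ q)), (μ n : ℝ) * a n -
      ∑ n ∈ ((Icc 1 (W / p)).filter (fun n => Squarefree n ∧ ∀ q ∈ n.primeFactors, (p + 1) ≤ q)), (μ n : ℝ) * b n)| ≤
      h * Sa W * (∑ n ∈ ((Icc 1 W).filter (fun n => Squarefree n ∧ ∀ q ∈ n.primeFactors, L ≤ q)), b n - 1) := by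
    rw [hS, add_sub_cancel_left, Finset.mul_sum]
    refine (Finset.abs_sum_le_sum_abs _ _).trans (Finset.sum_le_sum fun p hp => ?_)
    obtain ⟨hpI, hpp⟩ := Finset.mem_filter.mp hp
    obtain ⟨hpL, hpW⟩ := Finset.mem_Icc.mp hpI
    have hbp : 0 ≤ b p := hb0 p hpp
    have hlt : W / p < W := Nat.div_lt_self hWpos hpp.one_lt
    have hih := ih (W / p) hlt (p + 1) (hL.trans (hpL.trans (Nat.le_succ p)))
    rw [abs_mul, abs_of_nonneg hbp]
    calc b p * |∑ n ∈ ((Icc 1 (W / p)).filter (fun n => Squarefree n ∧ ∀ q ∈ n.primeFactors, (p + 1) ≤ q)), (μ n : ℝ) * a n - ∑ n ∈ ((Icc 1 (W / p)).filter (fun n => Squarefree n ∧ ∀ q ∈ n.primeFactors, (p + 1) ≤ q)), (μ n : ℝ) * b n|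
        = b p * |∑ n ∈ ((Icc 1 (W / p)).filter (fun n => Squarefree n ∧ ∀ q ∈ n.primeFactors, (p + 1) ≤ q)), ((μ n : ℝ) * a n - (μ n : ℝ) * b n)| := by
          rw [Finset.sum_sub_distrib]
      _ ≤ b p * (h * Sa (W / p) * ∑ n ∈ ((Icc 1 (W / p)).filter (fun n => Squarefree n ∧ ∀ q ∈ n.primeFactors, (p + 1) ≤ q)), b n) :=
          mul_le_mul_of_nonneg_left hih hbp
      _ ≤ b p * (h * Sa W * ∑ n ∈ ((Icc 1 (W / p)).filter (fun n => Squarefree n ∧ ∀ q ∈ n.primeFactors, (p + 1) ≤ q)), b n) := by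
          refine mul_le_mul_of_nonneg_left ?_ hbp
          refine mul_le_mul_of_nonneg_right ?_ (hSb_nonneg _ _)
          exact mul_le_mul_of_nonneg_left (hSa_mono hlt.le) hh
      _ = h * Sa W * (b p * ∑ n ∈ ((Icc 1 (W / p)).filter (fun n => Squarefree n ∧ ∀ q ∈ n.primeFactors, (p + 1) ≤ q)), b n) := by ring
  -- conclusion
  have hdecomp : ∑ n ∈ ((Icc 1 W).filter (fun n => Squarefree n ∧ ∀ q ∈ n.primeFactors, L ≤ q)), ((μ n : ℝ) * a n - (μ n : ℝ) * b n) =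
      -(∑ p ∈ ((Icc L W).filter Nat.Prime), (a p - b p) * ∑ n ∈ ((Icc 1 (W / p)).filter (fun n => Squarefree n ∧ ∀ q ∈ n.primeFactors, (p + 1) ≤ q)), (μ n : ℝ) * a n) -
        ∑ p ∈ ((Icc L W).filter Nat.Prime), b p * (∑ n ∈ ((Icc 1 (W / p)).filter (fun n => Squarefree n ∧ ∀ q ∈ n.primeFactors, (p + 1) ≤ q)), (μ n : ℝ) * a n -
          ∑ n ∈ ((Icc 1 (W / p)).filter (fun n => Squarefree n ∧ ∀ q ∈ n.primeFactors, (p + 1) ≤ q)), (μ n : ℝ) * b n) := by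
    rw [Finset.sum_sub_distrib, hA, hB]
    simp only [sub_mul, mul_sub, Finset.sum_sub_distrib]
    ring
  rw [hdecomp]
  calc |-(∑ p ∈ ((Icc L W).filter Nat.Prime), (a p - b p) * ∑ n ∈ ((Icc 1 (W / p)).filter (fun n => Squarefree n ∧ ∀ q ∈ n.primeFactors, (p + 1) ≤ q)), (μ n : ℝ) * a n) -
        ∑ p ∈ ((Icc L W).filter Nat.Prime), b p * (∑ n ∈ ((Icc 1 (W / p)).filter (fun n => Squarefree n ∧ ∀ q ∈ n.primeFactors, (p + 1) ≤ q)), (μ n : ℝ) * a n -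
          ∑ n ∈ ((Icc 1 (W / p)).filter (fun n => Squarefree n ∧ ∀ q ∈ n.primeFactors, (p + 1) ≤ q)), (μ n : ℝ) * b n)|
      ≤ |∑ p ∈ ((Icc L W).filter Nat.Prime), (a p - b p) * ∑ n ∈ ((Icc 1 (W / p)).filter (fun n => Squarefree n ∧ ∀ q ∈ n.primeFactors, (p + 1) ≤ q)), (μ n : ℝ) * a n| +
        |∑ p ∈ ((Icc L W).filter Nat.Prime), b p * (∑ n ∈ ((Icc 1 (W / p)).filter (fun n => Squarefree n ∧ ∀ q ∈ n.primeFactors, (p + 1) ≤ q)), (μ n : ℝ) * a n -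
          ∑ n ∈ ((Icc 1 (W / p)).filter (fun n => Squarefree n ∧ ∀ q ∈ n.primeFactors, (p + 1) ≤ q)), (μ n : ℝ) * b n)| := by
        rw [neg_sub_left, abs_neg, add_comm]
        exact abs_add_le _ _
    _ ≤ h * Sa W + h * Sa W * (∑ n ∈ ((Icc 1 W).filter (fun n => Squarefree n ∧ ∀ q ∈ n.primeFactors, L ≤ q)), b n - 1) := add_le_add hT1 hT2
    _ = h * Sa W * ∑ n ∈ ((Icc 1 W).filter (fun n => Squarefree n ∧ ∀ q ∈ n.primeFactors, L ≤ q)), b n := by ring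

/-! ### From "coprime to `P(z)`" to "rough squarefree", and the smooth–rough factorisation -/

/-- `(n, ∏_{q<N} q) = 1` iff every prime factor of `n` is `≥ N` (for `n ≠ 0`). [folklore] -/
theorem coprime_prod_primesBelow_iff {n : ℕ} (hn : n ≠ 0) (N : ℕ) :
    n.Coprime (∏ q ∈ N.primesBelow, q) ↔ ∀ q ∈ n.primeFactors, N ≤ q := by
  rw [Nat.coprime_prod_right_iff]
  constructor
  · intro h q hq
    have hqp := Nat.prime_of_mem_primeFactors hq
    by_contra hlt
    have hmem : q ∈ N.primesBelow := Nat.mem_primesBelow.mpr ⟨by omega, hqp⟩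
    have := h q hmem
    rw [Nat.coprime_comm, hqp.coprime_iff_not_dvd] at this
    exact this (Nat.dvd_of_mem_primeFactors hq)
  · intro h q hq
    obtain ⟨hqN, hqp⟩ := Nat.mem_primesBelow.mp hq
    rw [Nat.coprime_comm, hqp.coprime_iff_not_dvd]
    intro hd
    have := h q (Nat.mem_primeFactors.mpr ⟨hqp, hd, hn⟩)
    omega

/-- With a Möbius factor the sum over `n ≤ M` coprime to `∏_{q<N} q` is the sum over the rough
squarefree numbers `((Icc 1 M).filter (fun n => Squarefree n ∧ ∀ q ∈ n.primeFactors, N ≤ q))` (non-squarefree terms vanish). [folklore] -/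
theorem sum_coprime_moebius_mul_eq_sum_roughSquarefree (θ : ℕ → ℝ) (M N : ℕ) :
    ∑ n ∈ (Icc 1 M).filter (fun n => n.Coprime (∏ q ∈ N.primesBelow, q)), (μ n : ℝ) * θ n =
      ∑ n ∈ (Icc 1 M).filter (fun n => Squarefree n ∧ ∀ q ∈ n.primeFactors, N ≤ q),
        (μ n : ℝ) * θ n := by
  symm
  refine Finset.sum_subset (fun n hn => ?_) (fun n hn hn' => ?_)
  · obtain ⟨hnI, hsq, hq⟩ := Finset.mem_filter.mp hn
    have hn0 : n ≠ 0 := by have := (Finset.mem_Icc.mp hnI).1; omega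
    exact Finset.mem_filter.mpr ⟨hnI, (coprime_prod_primesBelow_iff hn0 N).mpr hq⟩
  · obtain ⟨hnI, hcop⟩ := Finset.mem_filter.mp hn
    have hn0 : n ≠ 0 := by have := (Finset.mem_Icc.mp hnI).1; omega
    have hnsq : ¬Squarefree n := fun hsq =>
      hn' (Finset.mem_filter.mpr ⟨hnI, hsq, (coprime_prod_primesBelow_iff hn0 N).mp hcop⟩)
    rw [ArithmeticFunction.moebius_eq_zero_of_not_squarefree hnsq]
    simp

/-- **Summing a Dirichlet convolution**: `∑_{d ≤ Y} (f * g)(d) = ∑_{m ≤ Y} f(m) ∑_{n ≤ Y/m} g(n)`.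
This is Mathlib's `ArithmeticFunction.sum_Ioc_mul_eq_sum_sum` with `Icc 1` for `Ioc 0` (kept as a
one-line corollary in the indexing used throughout the `AsymptoticSieveForPrimes*` files). [folklore] -/
theorem sum_Icc_mul_apply (f g : ArithmeticFunction ℝ) (Y : ℕ) :
    ∑ d ∈ Icc 1 Y, (f * g) d = ∑ m ∈ Icc 1 Y, f m * ∑ n ∈ Icc 1 (Y / m), g n := by
  have h := ArithmeticFunction.sum_Ioc_mul_eq_sum_sum f g Y
  simpa only [← Finset.Icc_add_one_left_eq_Ioc, zero_add] using h

/-- **Smooth–rough factorisation of a multiplicative sum**: for multiplicative `a` and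
`P = ∏_{q < N} q`,
`∑_{d ≤ Y} a(d) = ∑_{m ≤ Y, m N-smooth} a(m) ∑_{n ≤ Y/m, (n, P) = 1} a(n)`
(`a = (a·1_{smooth}) * (a·1_{rough})` as Dirichlet series, checked on prime powers). This is the
splitting "`G_ν(y) = ∑∑_{mn ≤ y, m | P(z), (n, P(z)) = 1} μ(m)μ(n)g(m)g(n)`" of FI p. 1048.
[cite: FriedlanderIwaniecASP1998, §2 p. 1048] -/
theorem sum_eq_sum_smooth_mul_sum_coprime {a : ArithmeticFunction ℝ} (ha : a.IsMultiplicative)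
    (N Y : ℕ) :
    ∑ d ∈ Icc 1 Y, a d =
      ∑ m ∈ (Icc 1 Y).filter (· ∈ N.smoothNumbers),
        a m * ∑ n ∈ (Icc 1 (Y / m)).filter (fun n => n.Coprime (∏ q ∈ N.primesBelow, q)), a n := by
  classical
  set P : ℕ := ∏ q ∈ N.primesBelow, q with hP
  set aS : ArithmeticFunction ℝ := ⟨fun m => if m ∈ N.smoothNumbers then a m else 0, by
    show (if (0 : ℕ) ∈ N.smoothNumbers then a 0 else 0) = 0
    rw [if_neg]
    exact fun h => Nat.ne_zero_of_mem_smoothNumbers h rfl⟩ with haS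
  set aR : ArithmeticFunction ℝ := ⟨fun n => if n.Coprime P then a n else 0, by simp⟩ with haR
  have haS_apply : ∀ m : ℕ, aS m = if m ∈ N.smoothNumbers then a m else 0 := fun m => rfl
  have haR_apply : ∀ n : ℕ, aR n = if n.Coprime P then a n else 0 := fun n => rfl
  have one_mem : (1 : ℕ) ∈ N.smoothNumbers :=
    Nat.mem_smoothNumbers'.mpr fun _ hp hd => absurd (Nat.dvd_one.mp hd) hp.ne_one
  -- multiplicativity
  have haSm : aS.IsMultiplicative := by
    refine ⟨?_, ?_⟩
    · rw [haS_apply, if_pos one_mem, ha.map_one]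
    · intro m n hmn
      rw [haS_apply, haS_apply, haS_apply, ha.map_mul_of_coprime hmn]
      by_cases hm : m ∈ N.smoothNumbers
      · by_cases hn' : n ∈ N.smoothNumbers
        · rw [if_pos (Nat.mul_mem_smoothNumbers hm hn'), if_pos hm, if_pos hn']
        · rw [if_neg, if_pos hm, if_neg hn', mul_zero]
          exact fun h => hn' (Nat.mem_smoothNumbers_of_dvd h (dvd_mul_left n m))
      · rw [if_neg, if_neg hm, zero_mul]
        exact fun h => hm (Nat.mem_smoothNumbers_of_dvd h (dvd_mul_right m n))
  have haRm : aR.IsMultiplicative := by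
    refine ⟨?_, ?_⟩
    · rw [haR_apply, if_pos (Nat.coprime_one_left _), ha.map_one]
    · intro m n hmn
      rw [haR_apply, haR_apply, haR_apply, ha.map_mul_of_coprime hmn]
      by_cases hm : m.Coprime P
      · by_cases hn' : n.Coprime P
        · rw [if_pos (Nat.Coprime.mul_left hm hn'), if_pos hm, if_pos hn']
        · rw [if_neg (fun h => hn' (Nat.coprime_mul_iff_left.mp h).2), if_pos hm, if_neg hn',
            mul_zero]
      · rw [if_neg (fun h => hm (Nat.coprime_mul_iff_left.mp h).1), if_neg hm, zero_mul]
  -- `aS * aR = a` on prime powers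
  have hkey : aS * aR = a := by
    rw [ArithmeticFunction.IsMultiplicative.eq_iff_eq_on_prime_powers _ (haSm.mul haRm) _ ha]
    intro p i hp
    rw [ArithmeticFunction.mul_apply,
      Nat.sum_divisorsAntidiagonal (f := fun x y => aS x * aR y), Nat.sum_divisors_prime_pow hp]
    by_cases hpN : p < N
    · -- `p` is smooth: only `j = i` survives
      rw [Finset.sum_eq_single_of_mem i (Finset.mem_range.mpr (Nat.lt_succ_self i))]
      · rw [Nat.div_self (pow_pos hp.pos i), haR_apply, if_pos (Nat.coprime_one_left _), ha.map_one,
          mul_one, haS_apply, if_pos]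
        exact Nat.mem_smoothNumbers'.mpr fun q hq hqd => by
          rwa [(Nat.prime_dvd_prime_iff_eq hq hp).mp (hq.dvd_of_dvd_pow hqd)]
      · intro j hj hji
        have hj' : j < i := lt_of_le_of_ne (Nat.lt_succ_iff.mp (Finset.mem_range.mp hj)) hji
        rw [Nat.pow_div hj'.le hp.pos, haR_apply, if_neg, mul_zero]
        rw [Nat.coprime_pow_left_iff (Nat.sub_pos_of_lt hj'), hp.coprime_iff_not_dvd,
          MoebiusRough.prime_dvd_prod_primesBelow_iff hp]
        exact fun h => h hpN
    · -- `p` is rough: only `j = 0` survives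
      rw [Finset.sum_eq_single_of_mem 0 (Finset.mem_range.mpr (Nat.succ_pos i))]
      · rw [pow_zero, Nat.div_one, haS_apply, if_pos one_mem, ha.map_one, one_mul, haR_apply,
          if_pos]
        rcases Nat.eq_zero_or_pos i with rfl | hi
        · rw [pow_zero]; exact Nat.coprime_one_left _
        · rw [Nat.coprime_pow_left_iff hi, hp.coprime_iff_not_dvd, MoebiusRough.prime_dvd_prod_primesBelow_iff hp]
          exact hpN
      · intro j hj hj0
        have hj1 : 1 ≤ j := Nat.one_le_iff_ne_zero.mpr hj0
        rw [haS_apply, if_neg, zero_mul]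
        intro hmem
        have := Nat.mem_smoothNumbers'.mp hmem p hp (dvd_pow_self p hj0)
        exact hpN this
  -- conclude
  have h1 : ∑ d ∈ Icc 1 Y, a d = ∑ d ∈ Icc 1 Y, (aS * aR) d := by rw [hkey]
  rw [h1, sum_Icc_mul_apply, Finset.sum_filter]
  refine Finset.sum_congr rfl fun m hm => ?_
  rw [haS_apply]
  split_ifs with hms
  · congr 1
    rw [Finset.sum_filter]
    refine Finset.sum_congr rfl fun n _ => ?_
    rw [haR_apply]
  · rw [zero_mul]

end FIComparison

end Literature.NumberTheory.Sieve
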